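import Mathlib
import Summits.ValiantsHypothesis.ValiantsHypothesis.Theorems.BinomialElusiveBinomialMapsElusiveTrinomialIndependence

/-!
# ValiantsHypothesis / BinomialElusive — translated toric maps do not swallow the E-curve

Support file for crux `BinomialMapsElusive` (stmt-ValiantsHypothesis-7393): the sub-class of binomial
maps whose second monomial is a CONSTANT.  For all `m ≥ 4`, no map `Γ : ℂ^{m-1} → ℂ^m` of the form
`Γ_i(z) = α_i z^{μ_i} + β_i` (one monomial of ARBITRARY degree plus a constant, per coordinate) has
image containing the route's E-curve `x ↦ (x^{E(2i+1)} + x^{E(2i+2)})_i`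
(`affineMonomialMapsElusive`; MvPolynomial form `binomialMapsElusive_of_monomial_add_const`).
This extends the support `ToricBinomialElusive` (stmt-7394, `β = 0`) by the translations, i.e. it
disposes of the crux's "free correction term `E(x)`" worry (docstring of stmt-7393) when `E` is constant.

Proof (elementary and POINTWISE, as for the toric case — no Puiseux series):
* containment at `x = 0, 1` forces `α_i ≠ 0`; on the curve `α_i y^{μ_i} = P_i(x)` with
  `P_i = X^{A_i} + X^{B_i} - β_i`, `A_i = E(2i+1) < B_i = E(2i+2)`;
* `m` exponent vectors in `ℤ^{m-1}` have a nonzero integer left-kernel vector `λ`; splitting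
  `λ = λ⁺ - λ⁻` and multiplying, `a₋ ∏ P_i(x)^{λ⁺_i} = a₊ ∏ P_i(x)^{λ⁻_i}` for EVERY `x`, with nonzero
  constants `a_± = ∏ α_i^{λ^±_i}`; hence an identity of polynomials, hence of power series;
* the trinomials `P_i` are multiplicatively independent modulo constants (`no_trinomial_identity`,
  Theorems/BinomialElusiveBinomialMapsElusiveTrinomialIndependence.lean).

Only facts about the exponents used: `0 < A_i < B_i`, `A` injective, gaps injective (strict
convexity of `x ↦ x^k`, `h ≥ 2`), no gap equals an exponent (congruences `0` vs `1` mod `M`); all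
proved here for `E(j) = Σ_{k≤h} (jM)^k`, `M = (2m+2)^{h+1}`, `h = ⌊log₂ m⌋² ≥ 4`.  No route file is
imported; the curve is written out exactly as in the route decl.
-/

namespace Summit.ValiantsHypothesis.ValiantsHypothesis.Theorems.BinomialElusiveAffineMonomial

-- summit = sub-problem name (single-conjunct summit, D-0017 layout), so the namespace repeats it
set_option linter.dupNamespace false

open scoped BigOperators
open PowerSeries

section Cover


/-- Left-kernel vectors over `ℤ`: `m` vectors in `ℤ^s` with `s < m` have a nonzero integer relation
(strong rank condition; copy of the lemma in Theorems/BinomialElusiveToricBinomialElusive.lean, which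
imports the route file). -/
private theorem exists_ne_zero_int_leftKernel {m s : ℕ} (hsm : s < m) (E : Fin m → Fin s → ℕ) :
    ∃ l : Fin m → ℤ, l ≠ 0 ∧ ∀ j, ∑ i, l i * (E i j : ℤ) = 0 := by
  let L : (Fin m → ℤ) →ₗ[ℤ] (Fin s → ℤ) :=
    { toFun := fun l j => ∑ i, l i * (E i j : ℤ)
      map_add' := by
        intro x y; funext j
        simp only [Pi.add_apply, add_mul, Finset.sum_add_distrib]
      map_smul' := by
        intro r x; funext j
        simp only [Pi.smul_apply, smul_eq_mul, RingHom.id_apply, Finset.mul_sum, mul_assoc] }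
  have hnotinj : ¬ Function.Injective L := fun h =>
    absurd (le_of_fin_injective ℤ L h) (not_le.mpr hsm)
  rw [injective_iff_map_eq_zero] at hnotinj
  push Not at hnotinj
  obtain ⟨l, hl0, hlne⟩ := hnotinj
  exact ⟨l, hlne, fun j => congr_fun hl0 j⟩

/-- `∏_i (κ_i ∏_j y_j^{e_ij})^{n_i} = (∏_i κ_i^{n_i}) ∏_j y_j^{∑_i e_ij n_i}` (copy of the toric file's
bookkeeping lemma). -/
private theorem prod_monomial_pow {m s : ℕ} (κ : Fin m → ℂ) (e : Fin m → Fin s → ℕ) (y : Fin s → ℂ)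
    (n : Fin m → ℕ) :
    ∏ i, (κ i * ∏ j, y j ^ e i j) ^ n i = (∏ i, κ i ^ n i) * ∏ j, y j ^ (∑ i, e i j * n i) := by
  calc ∏ i, (κ i * ∏ j, y j ^ e i j) ^ n i
      = ∏ i, (κ i ^ n i * ∏ j, y j ^ (e i j * n i)) := by
        refine Finset.prod_congr rfl fun i _ => ?_
        rw [mul_pow, ← Finset.prod_pow]
        refine congrArg _ (Finset.prod_congr rfl fun j _ => ?_)
        rw [pow_mul]
    _ = (∏ i, κ i ^ n i) * ∏ i, ∏ j, y j ^ (e i j * n i) := Finset.prod_mul_distrib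
    _ = (∏ i, κ i ^ n i) * ∏ j, y j ^ (∑ i, e i j * n i) := by
        rw [Finset.prod_comm]
        refine congrArg _ (Finset.prod_congr rfl fun j _ => ?_)
        rw [Finset.prod_pow_eq_pow_sum]


open Polynomial

/-- **Core contradiction.**  If `0 < A_i < B_i`, `A` and the gaps `B_i - A_i` are injective and no
gap is an exponent, then no map `y ↦ (α_i ∏_j y_j^{μ_ij} + β_i)_i` from `s < m` variables covers
all points `(x^{A_i} + x^{B_i})_i`, `x ∈ ℂ`. -/
theorem core_affine_false {m s : ℕ} (hsm : s < m) (A B : Fin m → ℕ) (hA : ∀ i, 0 < A i)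
    (hAB : ∀ i, A i < B i) (hAinj : Function.Injective A)
    (hcinj : Function.Injective fun i => B i - A i) (hcA : ∀ i j, B i - A i ≠ A j)
    (μ : Fin m → Fin s → ℕ) (α β : Fin m → ℂ)
    (hcover : ∀ x : ℂ, ∃ y : Fin s → ℂ, ∀ i, α i * ∏ j, y j ^ μ i j + β i = x ^ A i + x ^ B i) :
    False := by
  classical
  -- `α_i ≠ 0` (compare `x = 0` and `x = 1`)
  have hα : ∀ i, α i ≠ 0 := by
    intro i hαi
    obtain ⟨y₀, hy₀⟩ := hcover 0
    obtain ⟨y₁, hy₁⟩ := hcover 1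
    have h0 := hy₀ i
    have h1 := hy₁ i
    rw [hαi, zero_mul, zero_add, zero_pow (hA i).ne', zero_pow (Nat.ne_of_gt (lt_trans (hA i) (hAB i))),
      add_zero] at h0
    rw [hαi, zero_mul, zero_add, one_pow, one_pow, h0] at h1
    norm_num at h1
  -- an integer relation among the exponent vectors
  obtain ⟨l, hlne, hlker⟩ := exists_ne_zero_int_leftKernel hsm μ
  set kp : Fin m → ℕ := fun i => (l i).toNat with hkp
  set km : Fin m → ℕ := fun i => (-l i).toNat with hkm
  have hdisj : ∀ i, kp i = 0 ∨ km i = 0 := by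
    intro i
    rcases le_or_gt 0 (l i) with h | h
    · right; simp only [hkm, Int.toNat_eq_zero]; omega
    · left; simp only [hkp, Int.toNat_eq_zero]; omega
  have hne : kp ≠ 0 ∨ km ≠ 0 := by
    by_contra hcon
    push Not at hcon
    apply hlne
    funext i
    have h1 := congr_fun hcon.1 i
    have h2 := congr_fun hcon.2 i
    simp only [hkp, hkm, Pi.zero_apply, Int.toNat_eq_zero] at h1 h2
    simp only [Pi.zero_apply]; omega
  have hv : ∀ j, ∑ i, μ i j * kp i = ∑ i, μ i j * km i := by
    intro j
    have h2 : ∑ i, ((μ i j : ℤ) * ((l i).toNat : ℤ) - (μ i j : ℤ) * ((-l i).toNat : ℤ)) = 0 := by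
      rw [← hlker j]
      refine Finset.sum_congr rfl fun i _ => ?_
      rw [← mul_sub, Int.toNat_sub_toNat_neg, mul_comm]
    rw [Finset.sum_sub_distrib, sub_eq_zero] at h2
    exact_mod_cast h2
  -- the pointwise identity `a₋ ∏ P_i(x)^{k⁺} = a₊ ∏ P_i(x)^{k⁻}`
  set ap : ℂ := ∏ i, α i ^ kp i with hap
  set am : ℂ := ∏ i, α i ^ km i with ham
  have hap0 : ap ≠ 0 := Finset.prod_ne_zero_iff.mpr fun i _ => pow_ne_zero _ (hα i)
  have ham0 : am ≠ 0 := Finset.prod_ne_zero_iff.mpr fun i _ => pow_ne_zero _ (hα i)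
  have hpt : ∀ x : ℂ, am * ∏ i, (x ^ A i + x ^ B i - β i) ^ kp i
      = ap * ∏ i, (x ^ A i + x ^ B i - β i) ^ km i := by
    intro x
    obtain ⟨y, hy⟩ := hcover x
    have hP : ∀ i, x ^ A i + x ^ B i - β i = α i * ∏ j, y j ^ μ i j := fun i => by
      rw [← hy i]; ring
    simp only [hP, prod_monomial_pow, hv]
    rw [hap, ham]; ring
  -- hence an identity of polynomials, hence of power series
  set Pp : Fin m → ℂ[X] := fun i => Polynomial.X ^ A i + Polynomial.X ^ B i - Polynomial.C (β i)
    with hPp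
  have hpoly : Polynomial.C am * ∏ i, Pp i ^ kp i = Polynomial.C ap * ∏ i, Pp i ^ km i := by
    refine Polynomial.funext fun x => ?_
    simp only [hPp, Polynomial.eval_mul, Polynomial.eval_C, Polynomial.eval_prod, Polynomial.eval_pow,
      Polynomial.eval_sub, Polynomial.eval_add, Polynomial.eval_X]
    exact hpt x
  have hser : PowerSeries.C am * ∏ i, ((PowerSeries.X : ℂ⟦X⟧) ^ (A i) + PowerSeries.X ^ (B i) - PowerSeries.C (β i)) ^ kp i
      = PowerSeries.C ap * ∏ i, ((PowerSeries.X : ℂ⟦X⟧) ^ (A i) + PowerSeries.X ^ (B i) - PowerSeries.C (β i)) ^ km i := by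
    have h := congrArg (Polynomial.coeToPowerSeries.ringHom (R := ℂ)) hpoly
    simp only [map_mul, map_prod, map_pow, Polynomial.coeToPowerSeries.ringHom_apply,
      Polynomial.coe_C, hPp, Polynomial.coe_sub, Polynomial.coe_add, Polynomial.coe_pow,
      Polynomial.coe_X] at h
    exact h
  exact no_trinomial_identity A B hA hAB hAinj hcinj hcA β kp km hdisj hne ap am hap0 ham0 hser

end Cover

section ECurve

/-- The exponents `E(j) = Σ_{k ≤ h} (jM)^k` are positive (the `k = 0` term). -/
theorem expo_pos (m h j : ℕ) : 0 < (∑ k ∈ Finset.range (h + 1), (j * (2 * m + 2) ^ (h + 1)) ^ k) := by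
  rw [Finset.sum_range_succ']
  simp

/-- `E` is strictly increasing in `j` (for `h ≥ 1`). -/
theorem expo_lt_expo {m h j j' : ℕ} (hh : 1 ≤ h) (hjj : j < j') : (∑ k ∈ Finset.range (h + 1), (j * (2 * m + 2) ^ (h + 1)) ^ k) < (∑ k ∈ Finset.range (h + 1), (j' * (2 * m + 2) ^ (h + 1)) ^ k) := by
  refine Finset.sum_lt_sum (fun k _ => Nat.pow_le_pow_left (Nat.mul_le_mul_right _ hjj.le) k)
    ⟨1, Finset.mem_range.mpr (by omega), ?_⟩
  rw [pow_one, pow_one]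
  exact Nat.mul_lt_mul_of_pos_right hjj (by positivity)

/-- `E(j) ≡ 1 (mod M)`: `E(j) = 1 + M·(j Σ_{k<h} (jM)^k)`. -/
theorem expo_eq_one_add (m h j : ℕ) :
    (∑ k ∈ Finset.range (h + 1), (j * (2 * m + 2) ^ (h + 1)) ^ k) = 1 + (2 * m + 2) ^ (h + 1) * (j * ∑ k ∈ Finset.range h, (j * (2 * m + 2) ^ (h + 1)) ^ k) := by
  rw [Finset.sum_range_succ', pow_zero, add_comm, Finset.mul_sum, Finset.mul_sum]
  congr 1
  refine Finset.sum_congr rfl fun k _ => ?_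
  ring

/-- Convexity of `x ↦ x^k`: `f_k(x) = (x+1)^k - x^k` is monotone for `k ≥ 1` and strictly
monotone for `k ≥ 2` (integers `0 ≤ a ≤ b`). -/
theorem pow_succ_sub_pow_mono {a b : ℤ} (ha : 0 ≤ a) (hab : a ≤ b) :
    ∀ k : ℕ, 1 ≤ k → (a + 1) ^ k - a ^ k ≤ (b + 1) ^ k - b ^ k ∧
      (2 ≤ k → a < b → (a + 1) ^ k - a ^ k < (b + 1) ^ k - b ^ k) := by
  intro k
  induction k with
  | zero => intro h; omega
  | succ k ih =>
    intro _
    rcases Nat.eq_zero_or_pos k with rfl | hk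
    · simp
    · obtain ⟨ihle, _⟩ := ih hk
      have hrec : ∀ x : ℤ, (x + 1) ^ (k + 1) - x ^ (k + 1) = (x + 1) * ((x + 1) ^ k - x ^ k) + x ^ k := by
        intro x; ring
      have hfa : 0 ≤ (a + 1) ^ k - a ^ k := by
        have := pow_le_pow_left₀ ha (le_add_of_nonneg_right zero_le_one : a ≤ a + 1) k; linarith
      have hpk : a ^ k ≤ b ^ k := pow_le_pow_left₀ ha hab k
      refine ⟨?_, fun _ hlt => ?_⟩
      · rw [hrec a, hrec b]; nlinarith
      · rw [hrec a, hrec b]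
        have hpk' : a ^ k < b ^ k := pow_lt_pow_left₀ hlt ha hk.ne'
        nlinarith

/-- The gaps `E(2i+2) - E(2i+1)` are strictly increasing in `i` (for `h ≥ 2`), stated without
subtraction. -/
theorem gap_lt_gap {m h i i' : ℕ} (hh : 2 ≤ h) (hii : i < i') :
    (∑ k ∈ Finset.range (h + 1), ((2 * i + 2) * (2 * m + 2) ^ (h + 1)) ^ k) + (∑ k ∈ Finset.range (h + 1), ((2 * i' + 1) * (2 * m + 2) ^ (h + 1)) ^ k) < (∑ k ∈ Finset.range (h + 1), ((2 * i' + 2) * (2 * m + 2) ^ (h + 1)) ^ k) + (∑ k ∈ Finset.range (h + 1), ((2 * i + 1) * (2 * m + 2) ^ (h + 1)) ^ k) := by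
  rw [← Finset.sum_add_distrib, ← Finset.sum_add_distrib]
  -- compare termwise in `ℤ`
  have key : ∀ k ∈ Finset.range (h + 1),
      (((2 * i + 2) * (2 * m + 2) ^ (h + 1)) ^ k + ((2 * i' + 1) * (2 * m + 2) ^ (h + 1)) ^ k : ℕ)
        ≤ ((2 * i' + 2) * (2 * m + 2) ^ (h + 1)) ^ k + ((2 * i + 1) * (2 * m + 2) ^ (h + 1)) ^ k := by
    intro k hk
    rcases Nat.eq_zero_or_pos k with rfl | hk1
    · simp
    have h1 := (pow_succ_sub_pow_mono (a := (2 * i + 1 : ℤ)) (b := (2 * i' + 1 : ℤ)) (by positivity)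
      (by omega) k hk1).1
    have hM : (0 : ℤ) ≤ ((2 * m + 2) ^ (h + 1) : ℕ) ^ k := by positivity
    have h2 := mul_le_mul_of_nonneg_right h1 hM
    zify
    have e1 : ((2 * (i : ℤ) + 2)) = (2 * i + 1) + 1 := by ring
    have e2 : ((2 * (i' : ℤ) + 2)) = (2 * i' + 1) + 1 := by ring
    rw [mul_pow, mul_pow, mul_pow, mul_pow, e1, e2]
    push_cast at h2 ⊢
    nlinarith [h2]
  have strict : (((2 * i + 2) * (2 * m + 2) ^ (h + 1)) ^ 2 + ((2 * i' + 1) * (2 * m + 2) ^ (h + 1)) ^ 2 : ℕ)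
        < ((2 * i' + 2) * (2 * m + 2) ^ (h + 1)) ^ 2 + ((2 * i + 1) * (2 * m + 2) ^ (h + 1)) ^ 2 := by
    have h1 := (pow_succ_sub_pow_mono (a := (2 * i + 1 : ℤ)) (b := (2 * i' + 1 : ℤ)) (by positivity)
      (by omega) 2 (by norm_num)).2 le_rfl (by omega)
    have hM : (0 : ℤ) < ((2 * m + 2) ^ (h + 1) : ℕ) ^ 2 := by positivity
    have h2 := mul_lt_mul_of_pos_right h1 hM
    zify
    have e1 : ((2 * (i : ℤ) + 2)) = (2 * i + 1) + 1 := by ring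
    have e2 : ((2 * (i' : ℤ) + 2)) = (2 * i' + 1) + 1 := by ring
    rw [mul_pow, mul_pow, mul_pow, mul_pow, e1, e2]
    push_cast at h2 ⊢
    nlinarith [h2]
  exact Finset.sum_lt_sum key ⟨2, Finset.mem_range.mpr (by omega), strict⟩

/-- No gap is an exponent: `E(2i+2) - E(2i+1) ≠ E(j')` (congruences `0` vs `1` mod `M ≥ 2`),
stated without subtraction. -/
theorem gap_ne_expo (m h i j' : ℕ) : (∑ k ∈ Finset.range (h + 1), ((2 * i + 2) * (2 * m + 2) ^ (h + 1)) ^ k) ≠ (∑ k ∈ Finset.range (h + 1), (j' * (2 * m + 2) ^ (h + 1)) ^ k) + (∑ k ∈ Finset.range (h + 1), ((2 * i + 1) * (2 * m + 2) ^ (h + 1)) ^ k) := by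
  intro heq
  rw [expo_eq_one_add m h (2 * i + 2), expo_eq_one_add m h j', expo_eq_one_add m h (2 * i + 1)] at heq
  set M := (2 * m + 2) ^ (h + 1) with hM
  have hM2 : 2 ≤ M := by
    rw [hM]
    calc 2 ≤ 2 * m + 2 := by omega
      _ = (2 * m + 2) ^ 1 := (pow_one _).symm
      _ ≤ (2 * m + 2) ^ (h + 1) := Nat.pow_le_pow_right (by omega) (by omega)
  set R1 := (2 * i + 2) * ∑ k ∈ Finset.range h, ((2 * i + 2) * M) ^ k with hR1
  set R2 := j' * ∑ k ∈ Finset.range h, (j' * M) ^ k with hR2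
  set R3 := (2 * i + 1) * ∑ k ∈ Finset.range h, ((2 * i + 1) * M) ^ k with hR3
  have h1 : (1 + M * R1) % M = 1 % M := by rw [Nat.add_mul_mod_self_left]
  have h2 : (1 + M * R2 + (1 + M * R3)) % M = 2 % M := by
    rw [show 1 + M * R2 + (1 + M * R3) = 2 + M * (R2 + R3) by ring, Nat.add_mul_mod_self_left]
  rw [heq, h2] at h1
  -- `2 ≡ 1 (mod M)` forces `M ∣ 1`
  have hdvd : M ∣ 2 - 1 := (Nat.modEq_iff_dvd' (by norm_num)).mp h1.symm
  have : M ≤ 1 := Nat.le_of_dvd (by norm_num) hdvd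
  omega

/-- **Translated toric maps do not swallow the E-curve.**  For all `m ≥ 4` (so `h = ⌊log₂ m⌋² ≥ 4`)
and every map `y ↦ (α_i ∏_j y_j^{μ_ij} + β_i)_i : ℂ^{m-1} → ℂ^m` — one monomial of arbitrary degree plus
a constant in each coordinate — the E-curve of route BinomialElusive is not contained in its image. -/
theorem affineMonomialMapsElusive :
    ∀ m ≥ 4, ∀ (μ : Fin m → Fin (m - 1) → ℕ) (α β : Fin m → ℂ),
      ¬ (Set.range (fun x : ℂ => fun i : Fin m =>
          x ^ (∑ k ∈ Finset.range (Nat.log 2 m ^ 2 + 1),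
            ((2 * (i : ℕ) + 1) * (2 * m + 2) ^ (Nat.log 2 m ^ 2 + 1)) ^ k) +
          x ^ (∑ k ∈ Finset.range (Nat.log 2 m ^ 2 + 1),
            ((2 * (i : ℕ) + 2) * (2 * m + 2) ^ (Nat.log 2 m ^ 2 + 1)) ^ k))
        ⊆ Set.range (fun y : Fin (m - 1) → ℂ => fun i : Fin m => α i * ∏ j, y j ^ μ i j + β i)) := by
  intro m hm μ α β hsub
  set h := Nat.log 2 m ^ 2 with hh
  have hh2 : 2 ≤ h := by
    have : 2 ≤ Nat.log 2 m := Nat.le_log_of_pow_le (by norm_num) (by omega)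
    rw [hh]; nlinarith
  refine core_affine_false (s := m - 1) (by omega) (fun i : Fin m => (∑ k ∈ Finset.range (h + 1), ((2 * i + 1) * (2 * m + 2) ^ (h + 1)) ^ k))
    (fun i : Fin m => (∑ k ∈ Finset.range (h + 1), ((2 * i + 2) * (2 * m + 2) ^ (h + 1)) ^ k)) (fun i => expo_pos _ _ _)
    (fun i => expo_lt_expo (by omega) (by omega)) ?_ ?_ ?_ μ α β ?_
  · intro i j hij
    by_contra hne
    rcases lt_or_gt_of_ne (fun h => hne (Fin.ext h)) with hlt | hlt
    · exact absurd hij (expo_lt_expo (m := m) (h := h) (by omega) (by omega : 2 * (i:ℕ) + 1 < 2 * j + 1)).ne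
    · exact absurd hij (expo_lt_expo (m := m) (h := h) (by omega) (by omega : 2 * (j:ℕ) + 1 < 2 * i + 1)).ne'
  · intro i j hij
    simp only at hij
    by_contra hne
    have hi := expo_lt_expo (m := m) (h := h) (j := 2 * i + 1) (j' := 2 * i + 2) (by omega) (by omega)
    have hj := expo_lt_expo (m := m) (h := h) (j := 2 * j + 1) (j' := 2 * j + 2) (by omega) (by omega)
    rcases lt_or_gt_of_ne (fun h => hne (Fin.ext h)) with hlt | hlt
    · have := gap_lt_gap (m := m) hh2 hlt; omega
    · have := gap_lt_gap (m := m) hh2 hlt; omega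
  · intro i j heq
    have hi := expo_lt_expo (m := m) (h := h) (j := 2 * i + 1) (j' := 2 * i + 2) (by omega) (by omega)
    exact gap_ne_expo m h i (2 * j + 1) (by omega)
  · intro x
    obtain ⟨y, hy⟩ := hsub ⟨x, rfl⟩
    exact ⟨y, fun i => by simpa using congr_fun hy i⟩

/-- The same in the vocabulary of crux `BinomialMapsElusive` (stmt-ValiantsHypothesis-7393): binomial
maps `Γ` whose coordinates are `monomial + constant` do not swallow the E-curve, for every `m ≥ 4`. -/
theorem binomialMapsElusive_of_monomial_add_const :
    ∀ m ≥ 4, ∀ Γ : Fin m → MvPolynomial (Fin (m - 1)) ℂ,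
      (∀ i, ∃ (μ : Fin (m - 1) →₀ ℕ) (a b : ℂ), Γ i = MvPolynomial.monomial μ a + MvPolynomial.C b) →
      ¬ (Set.range (fun x : ℂ => fun i : Fin m =>
          x ^ (∑ k ∈ Finset.range (Nat.log 2 m ^ 2 + 1),
            ((2 * (i : ℕ) + 1) * (2 * m + 2) ^ (Nat.log 2 m ^ 2 + 1)) ^ k) +
          x ^ (∑ k ∈ Finset.range (Nat.log 2 m ^ 2 + 1),
            ((2 * (i : ℕ) + 2) * (2 * m + 2) ^ (Nat.log 2 m ^ 2 + 1)) ^ k))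
        ⊆ Set.range (fun y : Fin (m - 1) → ℂ => fun i : Fin m => MvPolynomial.eval y (Γ i))) := by
  intro m hm Γ hΓ hsub
  choose μ a b hΓ using hΓ
  refine affineMonomialMapsElusive m hm (fun i j => μ i j) a b (hsub.trans ?_)
  rintro _ ⟨y, rfl⟩
  refine ⟨y, funext fun i => ?_⟩
  dsimp only
  rw [hΓ i, map_add, MvPolynomial.eval_C, MvPolynomial.eval_monomial, Finsupp.prod_fintype _ _ (fun j => pow_zero _)]

end ECurve


section General

/-- **Translated toric maps versus general binomial curves** (the exponent-generic form of
`affineMonomialMapsElusive`, in the style of support `ToricBinomialElusive`): if `s < m`, the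
exponents satisfy `0 < a_i < b_i`, `a` is injective, the gaps `b_i - a_i` are pairwise distinct and no
gap equals an exponent `a_j`, then the binomial curve `x ↦ (x^{a_i} + x^{b_i})_i` is not contained in
the image of any map `y ↦ (α_i ∏_j y_j^{μ_ij} + β_i)_i : ℂ^s → ℂ^m` (one monomial of any degree plus a
constant per coordinate).  `β = 0` is the toric case. -/
theorem translatedToricBinomialElusive {m s : ℕ} (hsm : s < m) (a b : Fin m → ℕ)
    (ha : ∀ i, 0 < a i) (hab : ∀ i, a i < b i) (hainj : Function.Injective a)
    (hcinj : Function.Injective fun i => b i - a i) (hca : ∀ i j, b i - a i ≠ a j)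
    (μ : Fin m → Fin s → ℕ) (α β : Fin m → ℂ) :
    ¬ (Set.range (fun x : ℂ => fun i : Fin m => x ^ a i + x ^ b i)
        ⊆ Set.range (fun y : Fin s → ℂ => fun i : Fin m => α i * ∏ j, y j ^ μ i j + β i)) := by
  intro hsub
  refine core_affine_false hsm a b ha hab hainj hcinj hca μ α β fun x => ?_
  obtain ⟨y, hy⟩ := hsub ⟨x, rfl⟩
  exact ⟨y, fun i => by simpa using congr_fun hy i⟩

end General

end Summit.ValiantsHypothesis.ValiantsHypothesis.Theorems.BinomialElusiveAffineMonomial
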